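import Summits.QuantumFields.YangMills.Theses.UnitScaleTilt
import Literature.MathematicalPhysics.QuantumFieldTheory.Balaban1983to89.T3SplitLog
import Literature.MathematicalPhysics.QuantumFieldTheory.Balaban1983to89.T3UpperLiftSplitLog
import Literature.MathematicalPhysics.QuantumFieldTheory.Balaban1983to89.T3ExistSplit
import Summits.QuantumFields.YangMills.Theorems.UnitScaleTiltMinimiserStabilityRegPrAvgActionDefect
import Summits.QuantumFields.YangMills.Theorems.UnitScaleTiltMinimiserStabilityRegPrAvgCurvGrad
import Summits.QuantumFields.YangMills.Theorems.UnitScaleTiltMinimiserStabilityRegPrAttainmentOfLeaves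
import Summits.QuantumFields.YangMills.Theorems.UnitScaleTiltMinimiserStabilityRegPrSmoothLift
import Summits.QuantumFields.YangMills.Theorems.UnitScaleTiltMinimiserStabilityRegPrCritCurvGradLog
import Summits.QuantumFields.YangMills.Theorems.UnitScaleTiltMinimiserStabilityRegPrProp8Iter
import Summits.QuantumFields.YangMills.Theorems.UnitScaleTiltMinimiserStabilityRegPrAttainmentOfExist
import HarnessLib

/-!
# LAYER-4 BIRTH v10 of the K1 crux child «MinimiserStabilityRegPr» (stmt-QuantumFields-19200) = TWO STUBS {stub_halvingStep, stub_existenceMinimalOrbit}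
# (OWNER RULING g24-№5, HOME route-R3/ym/plan-g24/OWNER-RULING-g24-5-twoStubs.md; w2-19200 LOCATED FINDING #4, kernel-checked p590733 `AttainmentOfExist`)
# — penned by the route owner (ym3-torus-plan g24); registration by OPS on R-request C4c only (supersedes v8 5b4e846794b80374 and the un-executed v9 33b3e71f6fbd2e5d).
#
# v10 CHANGE (numbers, not adjectives).  The composition `MinimiserStabilityRegPr_of` (v5–v9 VERBATIM below `variational_of_leaves_log`) consumes the leaf V3 =
# [Balaban1985Variational] Prop. 7 from a background (14) ONLY through `T3ExistSplit.MinSixAttainedAt` (attainment over (6)), and attainment reads ONLY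
# clause (ii) «a minimal orbit in (6)(O₁L³B₃ε₁), ε₁ ≤ a′₁» — w2's `AttainmentOfExist.minSixAttainedAt_of_exist_prop8` (p590733) re-proves the v5 theorem
# `Variational.minSixAttainedAt_of_prop7_prop8` with `H7 ↦ H7.2`; clause (i) «at most one critical orbit» is projected NOWHERE on the path to the route decl
# (the crux is the stability of the MINIMAL ACTION VALUES `minActionRegPr_K(V)` between runs, [Balaban1985RegularSpaces] (1.9) — an `inf`, indifferent to
# uniqueness of the minimiser).  Hence v9's rows A (`stub_PV3A`, [Balaban1985RegularSpaces] Thm 2) and C-uniq (`stub_PV3Cuniq`) fed only the unread conjunct: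
# registered, they would be DECORATION (stubs on no path to the crux).  v10 keeps exactly the two load-bearing leaves:
#   H   `stub_halvingStep`          — [Balaban1985Variational] Prop. 8 one-step halving (v7∕v8∕v9 VERBATIM);
#   EX  `stub_existenceMinimalOrbit` — Prop. 7's EXISTENCE CLAUSE from a background, reading R1, member-uniform, radius O₁L³B₃ε₁ (v9 VERBATIM = line
#                                     «route-R»'s `RouteR.stub_existenceMinimalOrbit`, pen 5b75208179c6919a: one landing credits both lines);
# composition: EX (F n K form) ↦ carrier form (defeq) ↦ `minSixAttainedAt_of_exist_prop8` with `landed_prop8` ↦ v5's EXIST∕UPPER∕LOWER assembly unchanged.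
# PRINT'S ROUTE TO EX is where Thm 2 and Props 5–6 live: (α) [Balaban1985RegularSpaces] Thm 2 (row A; lit-balaban G-B8-T2S∕G-B9-LETTERS → `stub_PV3A_of_lettersAt`)
# + the ∃-half of Props 5–6 as a solution of (111) (E–L form) + (141)–(142) (E–L-critical in the window ⇒ minimal over (6)(e)) + Thm 2's covering (p.299) — it needs
# an E–L-criticality notion `IsCritEL` the carrier lacks (w2 FINDING #3: at reading R2 = `IsCritR2` every «∃ critical» is attainment); (β) direct method on the CLOSED
# fibre + KKT-halving interiority (unprinted).  Both are SUB-LEMMA PLANS OF THE STUB EX (card §3), not registered rows.  Prop. 7 (i) stays BANKED as theorems of the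
# tree (`Prop7PV3CUniqueness.atMostOneCriticalOrbit_of_A_Cuniq` p590201, `PV3D.stub_PV3D` p589019) for any downstream supplier that files a need for uniqueness.
# (v9∕v8∕v7 headers kept below for the record, compressed.)
# was (v9, never registered): V3 ⇐ A ∧ C-uniq ∧ EX (`prop7From14_v9`, clause (i) by `atMostOneCriticalOrbit_of_A_Cuniq`); rows D (landed) and E′ (documentary) out.
# was (v8): V3 `stub_prop7From14` REPLACED BY THE FOUR NATIVE PRINT ROWS P-V3-A ∕ C ∕ D ∕ E (OWNER RULING g24-№1 §A + A2′); composition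
# `Prop7PV3CDEAtSPrint.prop7From14At_v8` at `S_v8 := tPrintFam (sPrint L T)`; regime token `L³B₃ε₁ ≤ ε₂` of D mandatory (unregimed `axial18` refutable by
# `U₁ = 1, X = 0`, `T3SectALandauChart.in19_one_zero` + `regPr_gaugeAct_iff`).
# (v7 header kept below for the record.)
# was: LAYER-4 BIRTH v7 CANDIDATE … = registered v6 (636b1fa3b005b89b) WITH STUB V2 `stub_prop8` REPLACED BY THE ONE-STEP HALVING STUB `stub_halvingStep`
# (OWNER RULING g20-№2 (B)) and V4′ `stub_critCurvGradLog` LANDED (p511133).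

WHY V4′ (HOME/UV3-NODE.md §21; evidence #36 on 19200): v5's V4 = `B11.SectFPrinted B₃ (famX L)` is EXACTLY the `β = β₀ = 1` clause of [Balaban1985Variational] (9)
for critical configurations — print does not derive it ([Balaban1985RegularSpaces] Thm 2 (1.36) is `β₀ < 1`) and for the constrained minimiser it fails like
`(K − n)·log L`; every use tolerates a factor polynomial in `K − n` (`ε₁ = B₃·θBal(⌊K/m⌋)` decays geometrically), so V4′ is the log-Lipschitz statement
`CritCurvGradLogAt` (LANDED, p511133) and the compositions are the re-derived ones of `T3CurvGradLog` ∕ `T3SplitLog` ∕ `T3UpperLiftSplitLog`.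

Stubs (sorries ONLY here) — v10: `stub_halvingStep` (V2′, verbatim v7–v9), `stub_existenceMinimalOrbit` (V3 (ii), verbatim v9 = route-R).  Theorems with
no sorry of their own: `landed_prop8` (V2 ⇐ V2′, `Prop8Iter`), `stub_critCurvGradLog` (V4′, p511133), `landed_smoothLift` (p466834),
`landed_avgCurvGrad` (p440643), `landed_avgActionDefect` (p437535), `variational_of_leaves_log`, and the composition `MinimiserStabilityRegPr_of`, which concludes
the route decl BY NAME.
-/

noncomputable section

open MeasureTheory Filter Topology
open scoped Matrix.Norms.L2Operator
open Literature.MathematicalPhysics.QuantumFieldTheory.Balaban1983to89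
open Literature.MathematicalPhysics.QuantumFieldTheory.Balaban1983to89.T3ContinuumYM3Torus
open Literature.MathematicalPhysics.QuantumFieldTheory.Balaban1983to89.T3UnitLawDensityEML (ℰp measurableE_ℰp)
open Literature.MathematicalPhysics.QuantumFieldTheory.Balaban1983to89.T3UnitScaleTilt
open Literature.MathematicalPhysics.QuantumFieldTheory.Balaban1983to89.T3TiltDescent
open Literature.MathematicalPhysics.QuantumFieldTheory.Balaban1983to89.T3CruxEstimates
open Literature.MathematicalPhysics.QuantumFieldTheory.Balaban1983to89.T3ConstrainedMinimiser
open Literature.MathematicalPhysics.QuantumFieldTheory.Balaban1983to89.T3DescentFibreTower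
open Literature.MathematicalPhysics.QuantumFieldTheory.Balaban1983to89.T3MinimiserStabilityReduction
open Literature.MathematicalPhysics.QuantumFieldTheory.Balaban1983to89.T3RegularMinimiser
open Literature.MathematicalPhysics.QuantumFieldTheory.Balaban1983to89.T3PrintedRegularMinimiser
open Literature.MathematicalPhysics.QuantumFieldTheory.Balaban1983to89.T3PrintedRegularMinimiserReduction
open Literature.MathematicalPhysics.QuantumFieldTheory.Balaban1983to89.T3PrintedMinimiserExistence
open Literature.MathematicalPhysics.QuantumFieldTheory.Balaban1983to89.T3LowerAlongMinimisersSplit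
open Literature.MathematicalPhysics.QuantumFieldTheory.Balaban1983to89.T3AvgDivergenceSplit
open Literature.MathematicalPhysics.QuantumFieldTheory.Balaban1983to89.T3UpperAlongMinimisersSplit
open Literature.MathematicalPhysics.QuantumFieldTheory.Balaban1983to89.T3UpperLiftSplit
open Literature.MathematicalPhysics.QuantumFieldTheory.Balaban1983to89.T3LowerActionSplit
open Literature.MathematicalPhysics.QuantumFieldTheory.Balaban1983to89.T3ExistSplit
open Literature.MathematicalPhysics.QuantumFieldTheory.Balaban1983to89.T3Thm1Carrier
open Literature.MathematicalPhysics.QuantumFieldTheory.Balaban1983to89.T3CurvGradLog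
open Literature.MathematicalPhysics.QuantumFieldTheory.Balaban1983to89.T3SplitLog
open Literature.MathematicalPhysics.QuantumFieldTheory.Balaban1983to89.T3UpperLiftSplitLog
open Literature.MathematicalPhysics.QuantumFieldTheory.Balaban1983to89.B11 (Prop8Printed)
open Literature.MathematicalPhysics.QuantumFieldTheory.Balaban1983to89.T3Thm1CarrierNative (IsCritR2)

namespace Summit.QuantumFields.YangMills.Cruxes.MinimiserStabilityRegPr.BirthV10

/-! ## §1 Registered stubs (each a genuine lemma of the line; sorries live ONLY here) -/

/-- STUB V2′ — THE ONE-STEP HALVING of [Balaban1985Variational] Sect. F at the d = 3 carriers (p. 304, verbatim: «hence U_k belongs to the space (2) with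
max{B₃ε₁, ½ε₀} instead of ε₀»; Sect. F p. 300: «We will use only the fact that they are critical configurations of the functional (5) and that they belong to the
spaces (6) with ε₀ sufficiently small»), for SOME B₃ > 4 and a₅ > 0: `Prop8Printed`'s binders with the conclusion HALVED — for every member `i` (block size `L`,
heights `n < K`), `0 < ε₁`, every (7)-datum `V`, every `U ∈ 𝔘_k(ε₀) ∩ 𝔅_k(V)` critical in reading R2, `ε₀ ≤ a₅` ⇒ `U ∈ 𝔘_k(max{B₃ε₁, ½ε₀})` (OWNER RULING g20-№2 (B1)).
Equivalent readings (p1 g14 `Prop8Iter.halvingLiteral_iff_halvingStep` / `…_iff_native`): `∀ i, B11Prop8Assembly.HalvingStep (famX L i) B₃ a₅`,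
`T3Thm1CarrierNative.HalvingNativeAt L a₅ B₃`; reducible to MINIMISERS over (6)(ε₀), `0 < ε₀ ≤ a₅` (`Prop8Iter.halvingLiteral_of_minimisers`).
Content (work map, owner (B3)): [Balaban1985RegularSpaces] Thm 2 gauge (152), the flat constrained propagators of [Balaban1984PropagatorsII] (2.47)–(2.51) (162)–(164),
the datum bound (160), smallness (165)–(168). XL. [cite: Balaban1985Variational, Sect. F p.304 before Prop. 8] -/
theorem stub_halvingStep : ∀ (L : ℕ), 1 < L → ∃ B₃ : ℝ, 4 < B₃ ∧ ∃ a₅ : ℝ, 0 < a₅ ∧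
    ∀ (i : Idx L) (ε₀ ε₁ : ℝ), 0 < ε₁ → ∀ (V : (famX L i).Bdry) (U : (famX L i).Cfg), (famX L i).Reg7 ε₁ V → (famX L i).InU ε₀ U →
      (famX L i).InB V U → (famX L i).IsCritical V U → ε₀ ≤ a₅ → (famX L i).InU (max (B₃ * ε₁) (ε₀ / 2)) U := by
  sorry

-- (row D LANDED p589019 `…Theorems.PV3D.stub_PV3D`; row E′ documentary — RULING g24-№3′: both leave the skeleton)


/-- ROW (EX) — THE EXISTENCE CLAUSE OF PROP. 7 FROM A BACKGROUND (14), uniformly, reading R1 (text SHARED VERBATIM with line «route-R»'s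
`RouteR.stub_existenceMinimalOrbit`, p1 g10 pen v2 5b75208179c6919a — one landing credits both lines): for every `L > 1`, `B₃ > 4` SOME `a′₁ > 0`, `O₁ ≥ 1` such that
for every member, `0 < ε₁ ≤ a′₁`, every (7)-datum `V` and every background `U₀ ∈ 𝔘_k(L³B₃ε₁) ∩ 𝔅_k(V)` there is a MINIMISER of the Wilson action over print's regular
fibre `(6)(O₁L³B₃ε₁)`.  DISPLAYED AS ITSELF, honestly: print's internal route (Props 5–6 ∃ a solution of (111) → (141)–(142) local minimality → [B8] Thm 2 covering,
p.299) passes through E–L-criticality, which the carrier does not type (its `IsCritR2` = minimiser over SOME regular fibre makes every «∃ critical» statement an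
attainment statement — w2-19200 FINDING #3); attack routes recorded in the card: (α) print's chart route after an `IsCritEL` notion, (β) direct method on the CLOSED
fibre + KKT-halving interiority (unprinted).  Why it might fail: as typed it is implied by [Balaban1985Variational] Thm 1 (8) + Prop. 8, i.e. by print; the risk is
only in reading R1 vs print's «minimal orbit» (orbit-closure of an R1 minimiser is R1). [cite: Balaban1985Variational, Prop. 7 p.299, (14) p.280, (141)-(142) p.299, Thm 1 (8) p.279] -/
theorem stub_existenceMinimalOrbit : ∀ (L : ℕ), 1 < L → ∀ (B₃ : ℝ), 4 < B₃ → ∃ a₁' O₁ : ℝ, 0 < a₁' ∧ 1 ≤ O₁ ∧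
    ∀ (F : T3Family), F.L = L → ∀ (n K : ℕ) (hnK : n < K) (ε₁ : ℝ), 0 < ε₁ →
      ∀ V : GaugeField (F.P n) 0 (Matrix.specialUnitaryGroup (Fin 2) ℂ), PlaqSmall ε₁ V →
        ∀ U₀ : GaugeField (F.P K) 0 (Matrix.specialUnitaryGroup (Fin 2) ℂ), RegPr F n K ((L : ℝ) ^ 3 * B₃ * ε₁) U₀ → U₀ ∈ fibre F ℰp n K hnK.le V →
          ε₁ ≤ a₁' → ∃ U ∈ regFibrePr F n K hnK.le (O₁ * (L : ℝ) ^ 3 * B₃ * ε₁) V,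
            IsMinOn (fun W : GaugeField (F.P K) 0 (Matrix.specialUnitaryGroup (Fin 2) ℂ) => wilsonAction4 W)
              (regFibrePr F n K hnK.le (O₁ * (L : ℝ) ^ 3 * B₃ * ε₁) V) U := by
  sorry

/-- LANDED V2 (the v6 text of `stub_prop8`, now a theorem modulo V2′) — [Balaban1985Variational] PROPOSITION 8 at the d = 3 carriers for the SAME B₃ > 4, by the
kernel-checked halving iteration: p1 g14's `Summit.QuantumFields.YangMills.Theorems.Prop8Iter.prop8_of_halvingLiteral` over lit-balaban's
`B11Prop8Assembly.prop8Printed_of_halvingStep` («We continue this way until we reach the bound B₃ε₁»). [cite: Balaban1985Variational, Prop. 8 p.304] -/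
theorem landed_prop8 : ∀ (L : ℕ), 1 < L → ∃ B₃ : ℝ, 4 < B₃ ∧ Prop8Printed B₃ (famX L) :=
  Summit.QuantumFields.YangMills.Theorems.Prop8Iter.prop8_of_halvingLiteral stub_halvingStep

/-- LANDED V4′ — the log-Lipschitz curvature gradient of critical configurations in (8), p1 g13's
`Summit.QuantumFields.YangMills.Theorems.CritCurvGradLog.stub_critCurvGradLog` (p511133; proved for EVERY (8)-regular configuration, `regPr_curvGrad_lt`;
cell memo HOME/UV3-NODE.md §22). [cite: Balaban1985Variational, Thm 1 (9) p.279; Balaban1985RegularSpaces, Thm 2 p.83, (1.36) p.82] -/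
theorem stub_critCurvGradLog : ∀ (L : ℕ), 1 < L → ∀ B₃ : ℝ, 4 < B₃ → ∃ a₁ B₄ : ℝ, 0 < a₁ ∧ 0 < B₄ ∧ CritCurvGradLogAt L a₁ B₃ B₄ :=
  Summit.QuantumFields.YangMills.Theorems.CritCurvGradLog.stub_critCurvGradLog

/-! ## §2 Landed inputs, by name -/

/-- LANDED — located gap G-K1a-2′ (smooth exact one-step lift), v4's `stub_smoothLift`, p466834. [cite: King1986, (A.5) p.676] -/
theorem landed_smoothLift : ∀ (L : ℕ), ∃ C₁ C₂ c : ℝ, 0 < C₁ ∧ 0 ≤ C₂ ∧ 0 < c ∧ SmoothLiftAt L C₁ C₂ c :=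
  Summit.QuantumFields.YangMills.Theorems.SmoothLift.stub_smoothLift

/-- LANDED — located gap G-K1a-3a′ (first-order regularity of the one-step average), p440643. [cite: Balaban1985Averaging, Prop. 3 (122)-(123) p.36] -/
theorem landed_avgCurvGrad : ∀ (L : ℕ), ∃ C₁ C₂ c : ℝ, 0 ≤ C₁ ∧ 0 < C₂ ∧ 0 < c ∧ AvgCurvGradAt L C₁ C₂ c :=
  Summit.QuantumFields.YangMills.Theorems.AvgCurvGrad.stub_avgCurvGrad

/-- LANDED — located gap G-K1a-3b′ (per-configuration averaging action defect), p437535. [cite: Federbush1987PhaseCellIII, Thm 4.3 (4.5) p.299] -/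
theorem landed_avgActionDefect : ∀ (L : ℕ), ∃ C₂ c : ℝ, 0 ≤ C₂ ∧ 0 < c ∧ AvgActionDefectAt L C₂ c :=
  Summit.QuantumFields.YangMills.Theorems.AvgActionDefect.stub_avgActionDefect

/-- **THE VARIATIONAL DATA FROM THE LEAVES** (no sorry of its own): attainment over (6) from V3 (ii) = EX ∧ V2 (w2's p590733 `AttainmentOfExist.minSixAttainedAt_of_exist_prop8`),
`MinimisersIn8At` from V2 (p428575 `minimisersIn8At_of_prop8`), and the log-Lipschitz minimiser schema from V4′ ∧ V2 (`minimiserCurvGradLogAt_of_crit`).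
[cite: Balaban1985Variational, Thm 1 p.279, Prop 7 p.299, Prop 8 p.304] -/
theorem variational_of_leaves_log (L : ℕ) (hL : 1 < L) :
    ∃ â₀ â₁ a₀ a₁ B₃ B₄ : ℝ, 0 < â₀ ∧ 0 < â₁ ∧ 0 < a₀ ∧ 0 < a₁ ∧ 0 < B₃ ∧ 0 < B₄ ∧
      MinSixAttainedAt L â₀ â₁ B₃ ∧ MinimisersIn8At L a₀ a₁ B₃ ∧ MinimiserCurvGradLogAt L a₀ a₁ B₃ B₄ := by
  obtain ⟨B₃, hB₃, h8⟩ := landed_prop8 L hL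
  -- V3 (ii) = row (EX), converted from the `F n K` form (shared with line route-R) to the carrier form `famX`∕`OnMinimalOrbit` (anonymous-constructor defeq)
  obtain ⟨a₁', O₁, ha₁', hO₁, hE⟩ := stub_existenceMinimalOrbit L hL B₃ hB₃
  have h7 : ∃ a₁' O₁ : ℝ, 0 < a₁' ∧ 1 ≤ O₁ ∧ ∀ (i : Idx L) (ε₁ : ℝ), 0 < ε₁ → ε₁ ≤ a₁' → ∀ V : (famX L i).Bdry, (famX L i).Reg7 ε₁ V →
      ∀ U₀ : (famX L i).Cfg, (famX L i).InU ((L : ℝ) ^ 3 * B₃ * ε₁) U₀ → (famX L i).InB V U₀ →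
        ∃ U : (famX L i).Cfg, (famX L i).OnMinimalOrbit (O₁ * (L : ℝ) ^ 3 * B₃ * ε₁) V U := by
    refine ⟨a₁', O₁, ha₁', hO₁, ?_⟩
    intro i ε₁ hε₁ hε₁a V hV U₀ hU₀ hB
    obtain ⟨⟨F, n, K⟩, hF, hnK⟩ := i
    obtain ⟨U, hU, hmin⟩ := hE F hF n K hnK ε₁ hε₁ V hV U₀ hU₀ hB hε₁a
    exact ⟨U, hU, hmin⟩
  obtain ⟨a₁, B₄, ha₁, hB₄, hc⟩ := stub_critCurvGradLog L hL B₃ hB₃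
  have hB₃0 : 0 < B₃ := by linarith
  obtain ⟨â₀, â₁, hâ₀, hâ₁, hatt⟩ :=
    Summit.QuantumFields.YangMills.Theorems.AttainmentOfExist.minSixAttainedAt_of_exist_prop8 hL hB₃ h7 h8
  obtain ⟨a₅, ha₅, h8'⟩ := minimisersIn8At_of_prop8 hB₃0 h8
  exact ⟨â₀, â₁, a₅, a₁, B₃, B₄, hâ₀, hâ₁, ha₅, ha₁, hB₃0, hB₄, hatt, h8' a₁, minimiserCurvGradLogAt_of_crit hB₃0 hc (h8' a₁)⟩

/-! ## §3 The composition — concludes the ROUTE DECL by name, no sorry of its own -/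

/-- **`MinimiserStabilityRegPr ⇐ (stub_halvingStep ∧ stub_existenceMinimalOrbit) ∧ landed V4′ `stub_critCurvGradLog` ∧ landed_prop8 (iteration) ∧ landed_smoothLift ∧ landed_avgCurvGrad ∧ landed_avgActionDefect`**:
EXIST by `T3ExistSplit.hasRegMinimisersPrAt_of_attained`, UPPER by `T3UpperLiftSplitLog.upperAlongRegPrMinimisersAt_of_splitLog'`, LOWER by
`T3SplitLog.lowerAlongRegPrMinimisersAt_of_splitLog'''` (both through the log-Lipschitz schema with K-dependent windows), then
`minimiserStabilityRegPrAt_of_alongRegPrMinimisers`; ε₁ := min of three, m₀ := 10, γ₁ := min of three; `p₀ > 2 > 0`; `L ≤ 1` is vacuous. -/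
theorem MinimiserStabilityRegPr_of : Summit.QuantumFields.YangMills.Theses.UnitScaleTilt.MinimiserStabilityRegPr := by
  intro L
  by_cases hL : 1 < L
  · obtain ⟨â₀, â₁, a₀, a₁, B₃, B₄, hâ₀, hâ₁, ha₀, ha₁, hB₃, hB₄, hatt, hIn8, hgrad⟩ := variational_of_leaves_log L hL
    -- EXIST
    obtain ⟨e₁, he₁, hE⟩ := hasRegMinimisersPrAt_of_attained hâ₀ hâ₁ hB₃ hatt
    -- UPPER
    obtain ⟨C₁, C₂, c, hC₁, hC₂, hc, hlift⟩ := landed_smoothLift L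
    obtain ⟨e₂, he₂, hU⟩ := upperAlongRegPrMinimisersAt_of_splitLog' ha₀ ha₁ hB₃ hB₄ hC₁ hC₂ hc hIn8 hgrad hlift
    -- LOWER
    obtain ⟨D₁, D₂, d, hD₁, hD₂, hd, havg⟩ := landed_avgCurvGrad L
    obtain ⟨E₂, e, hE₂, he, hdef⟩ := landed_avgActionDefect L
    obtain ⟨e₃, he₃, hLo⟩ := lowerAlongRegPrMinimisersAt_of_splitLog''' hL.le ha₀ ha₁ hB₃ hB₄ hD₂ hd hE₂ he hIn8 hgrad havg hdef
    -- the common `ε₁`, `m₀ = 10`, `γ₁`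
    refine ⟨min e₁ (min e₂ e₃), lt_min he₁ (lt_min he₂ he₃), fun ε₀ hε hεle => ⟨10, fun m hm b₀ p₀ hb hp => ?_⟩⟩
    have hε₁ : ε₀ ≤ e₁ := hεle.trans (min_le_left _ _)
    have hε₂ : ε₀ ≤ e₂ := hεle.trans ((min_le_right _ _).trans (min_le_left _ _))
    have hε₃ : ε₀ ≤ e₃ := hεle.trans ((min_le_right _ _).trans (min_le_right _ _))
    have hm2 : 2 ≤ m := le_trans (by norm_num) hm
    have hp0 : 0 < p₀ := lt_trans two_pos hp
    obtain ⟨γa, hγa, hA⟩ := hE ε₀ hε hε₁ m hm2 b₀ p₀ hb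
    obtain ⟨γb, hγb, hB⟩ := hU ε₀ hε hε₂ m hm b₀ p₀ hb hp0
    obtain ⟨γc, hγc, hC⟩ := hLo ε₀ hε hε₃ m hm b₀ p₀ hb hp0
    refine ⟨min γa (min γb γc), lt_min hγa (lt_min hγb hγc), fun F γ hFL hγ hγle => ?_⟩
    have hγa' : γ ≤ γa := hγle.trans (min_le_left _ _)
    have hγb' : γ ≤ γb := hγle.trans ((min_le_right _ _).trans (min_le_left _ _))
    have hγc' : γ ≤ γc := hγle.trans ((min_le_right _ _).trans (min_le_right _ _))
    exact minimiserStabilityRegPrAt_of_alongRegPrMinimisers hγ.le (hA F γ hFL hγ hγa') (hB F γ hFL hγ hγb') (hC F γ hFL hγ hγc')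
  · -- no member of the family has block size `L ≤ 1`
    exact ⟨1, one_pos, fun ε₀ _ _ => ⟨0, fun m _ b₀ p₀ _ _ => ⟨1, one_pos, fun F γ hFL _ _ => absurd (hFL ▸ F.hL.2) hL⟩⟩⟩

end Summit.QuantumFields.YangMills.Cruxes.MinimiserStabilityRegPr.BirthV10

end
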